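import Summits.AnomalousDissipation.AnomalousDissipation.Theorems.MomentParityQuarticGateAxialQuadOffB

/-!
# Axial quadratic rigidity (stub S2q of line `axis-sectors`, crux `MomentParity.QuarticGate`):
# off-centre axial sectors, part C — collinear pairs inside the ball and assembly

* `offcentre_collinear_of_mem` — for `θ` in the ball, the collinear pairs `{(0,s,0), (0,m-s,0)}` die by
  `(POL)((1,0,0), (-1,s,0), ·)` once all non-collinear pairs are dead (part A);
* `offcentre_pos` — every block of an axial sector `θ = (0,m,0)`, `m > 0`, vanishes;
* `offcentre` — with AXIALITY of the block family, every block `Q a b` with `a + b ≠ 0` vanishes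
  (`m < 0` by the reflection `Q ↦ Q(-·,-·)`, which preserves all hypotheses).
-/

namespace Summit.AnomalousDissipation.AnomalousDissipation.Theorems.MomentParityQuarticGate.AxialQuad

open Matrix

-- `Summit.<Summit>.<Problem>` is the tree's mandated summit-side namespace (CONVENTIONS §2); for this
-- single-conjunct summit the two coincide, so the duplicate is deliberate.
set_option linter.dupNamespace false

variable (Q : (Fin 3 → ℤ) → (Fin 3 → ℤ) → Matrix (Fin 3) (Fin 3) ℂ) {N : ℕ}

/-- **Collinear pairs, `θ` in the ball.** For an axial `θ` in the punctured ball, the blocks of the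
collinear pairs `{(0,s,0), (0,m-s,0)}` vanish: the member with `1 + s² ≤ N²` peels as
`(1,0,0) + (-1,s,0)`, both companions being non-collinear pairs (dead by part A). [folklore] -/
theorem offcentre_collinear_of_mem (hsupp : (∀ a b : Fin 3 → ℤ, ¬ (((a : Fin 3 → ℤ) ≠ 0 ∧ (a) ⬝ᵥ (a) ≤ ((N : ℕ) : ℤ) ^ 2) ∧ ((b : Fin 3 → ℤ) ≠ 0 ∧ (b) ⬝ᵥ (b) ≤ ((N : ℕ) : ℤ) ^ 2)) → Q a b = 0)) (hsymm : ∀ a b, Q b a = (Q a b)ᵀ)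
    (hrow : ∀ a b, (fun i : Fin 3 => (((a : Fin 3 → ℤ) i : ℤ) : ℂ)) ᵥ* Q a b = 0) (hcol : ∀ a b, Q a b *ᵥ (fun i : Fin 3 => (((b : Fin 3 → ℤ) i : ℤ) : ℂ)) = 0) (hpol : (∀ (k₁ k₂ k₃ : Fin 3 → ℤ) (v₁ v₂ v₃ : Fin 3 → ℂ), ((k₁ : Fin 3 → ℤ) ≠ 0 ∧ (k₁) ⬝ᵥ (k₁) ≤ ((N : ℕ) : ℤ) ^ 2) → ((k₂ : Fin 3 → ℤ) ≠ 0 ∧ (k₂) ⬝ᵥ (k₂) ≤ ((N : ℕ) : ℤ) ^ 2) → ((k₃ : Fin 3 → ℤ) ≠ 0 ∧ (k₃) ⬝ᵥ (k₃) ≤ ((N : ℕ) : ℤ) ^ 2) → v₁ ⬝ᵥ (fun i : Fin 3 => (((k₁ : Fin 3 → ℤ) i : ℤ) : ℂ)) = 0 → v₂ ⬝ᵥ (fun i : Fin 3 => (((k₂ : Fin 3 → ℤ) i : ℤ) : ℂ)) = 0 → v₃ ⬝ᵥ (fun i : Fin 3 => (((k₃ : Fin 3 → ℤ) i : ℤ)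 : ℂ)) = 0 → (((v₁) ⬝ᵥ (fun i : Fin 3 => (((k₂ : Fin 3 → ℤ) i : ℤ) : ℂ))) • (v₂) + ((v₂) ⬝ᵥ (fun i : Fin 3 => (((k₁ : Fin 3 → ℤ) i : ℤ) : ℂ))) • (v₁) : Fin 3 → ℂ) ⬝ᵥ (Q (k₁ + k₂) k₃ *ᵥ v₃) + (((v₁) ⬝ᵥ (fun i : Fin 3 => (((k₃ : Fin 3 → ℤ) i : ℤ) : ℂ))) • (v₃) + ((v₃) ⬝ᵥ (fun i : Fin 3 => (((k₁ : Fin 3 → ℤ) i : ℤ) : ℂ))) • (v₁) : Fin 3 → ℂ) ⬝ᵥ (Q (k₁ + k₃) k₂ *ᵥ v₂) + (((v₂) ⬝ᵥ (fun i : Fin 3 => (((k₃ : Fin 3 → ℤ) i : ℤ) : ℂ))) • (v₃) + ((v₃) ⬝ᵥ (fun i : Fin 3 => (((k₂ : Fin 3 → ℤ) i : ℤ) : ℂ))) • (v₂) : Fin 3 → ℂ) ⬝ᵥ (Q (k₂ + k₃) k₁ *ᵥ v₁) = 0))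
    {θ : Fin 3 → ℤ} (hθ0 : θ 0 = 0) (hθ2 : θ 2 = 0) (hθ : ((θ : Fin 3 → ℤ) ≠ 0 ∧ (θ) ⬝ᵥ (θ) ≤ ((N : ℕ) : ℤ) ^ 2)) (hm : 0 < θ 1)
    (a b : Fin 3 → ℤ) (hab : a + b = θ) (hc : a ⨯₃ θ = 0) : Q a b = 0 := by
  -- the kill of a collinear block whose first member is short enough
  have hkill : ∀ a b : Fin 3 → ℤ, a + b = θ → ((b : Fin 3 → ℤ) ≠ 0 ∧ (b) ⬝ᵥ (b) ≤ ((N : ℕ) : ℤ) ^ 2) → a = ![0, a 1, 0] → a 1 ≠ 0 →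
      1 + a 1 * a 1 ≤ ((N : ℕ) : ℤ) ^ 2 → Q a b = 0 := by
    intro a b hab hb hav hs0 hsN
    have hb0 : b 0 = 0 := by have := congrFun hab 0; rw [hav] at this; simpa [hθ0] using this
    have hb2 : b 2 = 0 := by have := congrFun hab 2; rw [hav] at this; simpa [hθ2] using this
    have hb1 : b 1 = θ 1 - a 1 := by have := congrFun hab 1; simp only [Pi.add_apply] at this; linarith
    have hd₁ : Q (![1, 0, 0] + b) ![-1, a 1, 0] = 0 := by
      refine eq_zero_of_transpose Q hsymm (offcentre_noncollinear_of_mem Q hsupp hsymm hrow hcol hpol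
        hθ0 hθ2 hθ _ _ ?_ fun h => ?_)
      · ext i; fin_cases i <;> simp [hb0, hb2, hb1, hθ0, hθ2, Matrix.vecHead, Matrix.vecTail]
      · have := congrFun h 2; simp [cross_apply, hθ0] at this; omega
    have hd₂ : Q (![-1, a 1, 0] + b) ![1, 0, 0] = 0 := by
      have e : (![-1, a 1, 0] + b) = ![-1, θ 1, 0] := by
        ext i; fin_cases i <;> simp [hb0, hb2, hb1]
      refine offcentre_noncollinear_of_mem Q hsupp hsymm hrow hcol hpol hθ0 hθ2 hθ _ _ ?_ fun h => ?_
      · rw [e]; ext i; fin_cases i <;> simp [hθ0, hθ2]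
      · rw [e] at h; have := congrFun h 2; simp [cross_apply, hθ0] at this; omega
    have key := coll_kill Q hrow hcol hpol hs0 hsN hb hd₁ hd₂
    rwa [← hav] at key
  by_cases hmem : ((a : Fin 3 → ℤ) ≠ 0 ∧ (a) ⬝ᵥ (a) ≤ ((N : ℕ) : ℤ) ^ 2) ∧ ((b : Fin 3 → ℤ) ≠ 0 ∧ (b) ⬝ᵥ (b) ≤ ((N : ℕ) : ℤ) ^ 2)
  swap
  · exact hsupp a b hmem
  obtain ⟨hA, hB⟩ := hmem
  have hav := axial_of_cross_eq_zero hθ0 hθ2 hm.ne' hc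
  have hbc : b ⨯₃ θ = 0 := by
    have : b = θ - a := by rw [← hab]; abel
    rw [this, LinearMap.map_sub₂, cross_self, hc, sub_zero]
  have hbv := axial_of_cross_eq_zero hθ0 hθ2 hm.ne' hbc
  have hA2 := hA.2
  rw [hav, vec3_dotProduct, sq] at hA2
  simp only [cons_val_zero, cons_val_one, cons_val_two, head_cons, tail_cons, mul_zero, zero_add,
    add_zero] at hA2
  have hB2 := hB.2
  rw [hbv, vec3_dotProduct, sq] at hB2
  simp only [cons_val_zero, cons_val_one, cons_val_two, head_cons, tail_cons, mul_zero, zero_add,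
    add_zero] at hB2
  have hθ2' := hθ.2
  rw [vec3_dotProduct, hθ0, hθ2, sq] at hθ2'
  simp only [mul_zero, zero_add, add_zero] at hθ2'
  have hs0 : a 1 ≠ 0 := fun h => hA.1 (by rw [hav, h]; decide)
  have ht0 : b 1 ≠ 0 := fun h => hB.1 (by rw [hbv, h]; decide)
  have hsum : a 1 + b 1 = θ 1 := by have := congrFun hab 1; simpa using this
  have hN0 : (0 : ℤ) ≤ N := Nat.cast_nonneg N
  have hbN : -(N : ℤ) ≤ b 1 ∧ b 1 ≤ N := abs_le_of_sq_le_sq' (by rw [sq, sq]; exact hB2) hN0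
  have hmN : -(N : ℤ) ≤ θ 1 ∧ θ 1 ≤ N := abs_le_of_sq_le_sq' (by rw [sq, sq]; exact hθ2') hN0
  have hN1 : (1 : ℤ) ≤ N := by linarith [hmN.2]
  by_cases hsN : 1 + a 1 * a 1 ≤ ((N : ℕ) : ℤ) ^ 2
  · exact hkill a b hab hB hav hs0 hsN
  · -- then `|a₁| = N`, and the partner is short: `1 + b₁² ≤ N²`
    refine eq_zero_of_transpose Q hsymm (hkill b a ((add_comm b a).trans hab) hA hbv ht0 ?_)
    rw [sq] at hsN
    have ha1sq : a 1 * a 1 = (N : ℤ) * N :=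
      le_antisymm hA2 (Int.lt_add_one_iff.1 (by linarith [not_le.1 hsN]))
    have hb1le : |b 1| ≤ (N : ℤ) - 1 := by
      rcases mul_self_eq_mul_self_iff.1 ha1sq with h | h
      · exact abs_le.2 ⟨by omega, by omega⟩
      · exfalso; omega
    have h1 := mul_self_le_mul_self (abs_nonneg _) hb1le
    rw [abs_mul_abs_self] at h1
    have e : ((N : ℤ) - 1) * ((N : ℤ) - 1) = N * N - 2 * N + 1 := by ring
    rw [e] at h1
    rw [sq]
    linarith

/-- **An axial sector with `m > 0` carries no quadratic Casimir**: every block `Q a b` with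
`a + b = θ = (0, m, 0)`, `m > 0`, vanishes (`N ≥ 2`). [folklore] -/
theorem offcentre_pos (hN : 2 ≤ N) (hsupp : (∀ a b : Fin 3 → ℤ, ¬ (((a : Fin 3 → ℤ) ≠ 0 ∧ (a) ⬝ᵥ (a) ≤ ((N : ℕ) : ℤ) ^ 2) ∧ ((b : Fin 3 → ℤ) ≠ 0 ∧ (b) ⬝ᵥ (b) ≤ ((N : ℕ) : ℤ) ^ 2)) → Q a b = 0)) (hsymm : ∀ a b, Q b a = (Q a b)ᵀ)
    (hrow : ∀ a b, (fun i : Fin 3 => (((a : Fin 3 → ℤ) i : ℤ) : ℂ)) ᵥ* Q a b = 0) (hcol : ∀ a b, Q a b *ᵥ (fun i : Fin 3 => (((b : Fin 3 → ℤ) i : ℤ) : ℂ)) = 0) (hpol : (∀ (k₁ k₂ k₃ : Fin 3 → ℤ) (v₁ v₂ v₃ : Fin 3 → ℂ), ((k₁ : Fin 3 → ℤ) ≠ 0 ∧ (k₁) ⬝ᵥ (k₁) ≤ ((N : ℕ) : ℤ) ^ 2) → ((k₂ : Fin 3 → ℤ) ≠ 0 ∧ (k₂) ⬝ᵥ (k₂)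 ≤ ((N : ℕ) : ℤ) ^ 2) → ((k₃ : Fin 3 → ℤ) ≠ 0 ∧ (k₃) ⬝ᵥ (k₃) ≤ ((N : ℕ) : ℤ) ^ 2) → v₁ ⬝ᵥ (fun i : Fin 3 => (((k₁ : Fin 3 → ℤ) i : ℤ) : ℂ)) = 0 → v₂ ⬝ᵥ (fun i : Fin 3 => (((k₂ : Fin 3 → ℤ) i : ℤ) : ℂ)) = 0 → v₃ ⬝ᵥ (fun i : Fin 3 => (((k₃ : Fin 3 → ℤ) i : ℤ) : ℂ)) = 0 → (((v₁) ⬝ᵥ (fun i : Fin 3 => (((k₂ : Fin 3 → ℤ) i : ℤ) : ℂ))) • (v₂) + ((v₂) ⬝ᵥ (fun i : Fin 3 => (((k₁ : Fin 3 → ℤ) i : ℤ) : ℂ))) • (v₁) : Fin 3 → ℂ) ⬝ᵥ (Q (k₁ + k₂) k₃ *ᵥ v₃) + (((v₁) ⬝ᵥ (fun i : Fin 3 => (((k₃ : Fin 3 → ℤ) i : ℤ) : ℂ))) • (v₃) + ((v₃) ⬝ᵥ (fun i : Fin 3 => (((k₁ : Fin 3 → ℤ) i : ℤ) : ℂ)))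 • (v₁) : Fin 3 → ℂ) ⬝ᵥ (Q (k₁ + k₃) k₂ *ᵥ v₂) + (((v₂) ⬝ᵥ (fun i : Fin 3 => (((k₃ : Fin 3 → ℤ) i : ℤ) : ℂ))) • (v₃) + ((v₃) ⬝ᵥ (fun i : Fin 3 => (((k₂ : Fin 3 → ℤ) i : ℤ) : ℂ))) • (v₂) : Fin 3 → ℂ) ⬝ᵥ (Q (k₂ + k₃) k₁ *ᵥ v₁) = 0))
    {θ : Fin 3 → ℤ} (hθ0 : θ 0 = 0) (hθ2 : θ 2 = 0) (hm : 0 < θ 1) (a b : Fin 3 → ℤ)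
    (hab : a + b = θ) : Q a b = 0 := by
  by_cases hθB : θ ⬝ᵥ θ ≤ ((N : ℕ) : ℤ) ^ 2
  · have hθ : ((θ : Fin 3 → ℤ) ≠ 0 ∧ (θ) ⬝ᵥ (θ) ≤ ((N : ℕ) : ℤ) ^ 2) := ⟨fun h => hm.ne' (by rw [h]; rfl), hθB⟩
    by_cases hc : a ⨯₃ θ = 0
    · exact offcentre_collinear_of_mem Q hsupp hsymm hrow hcol hpol hθ0 hθ2 hθ hm a b hab hc
    · exact offcentre_noncollinear_of_mem Q hsupp hsymm hrow hcol hpol hθ0 hθ2 hθ a b hab hc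
  · exact offcentre_of_not_mem Q hN hsupp hsymm hrow hcol hpol hθ0 hθ2 hm (not_le.1 hθB) a b hab

/-- **OFF-CENTRE VANISHING.** If the block family is AXIAL (a block `Q a b` is nonzero only when
`a + b` lies on the axis `ℤ e₁`), then every block with `a + b ≠ 0` vanishes (`N ≥ 2`). [folklore] -/
theorem offcentre (hN : 2 ≤ N) (hsupp : (∀ a b : Fin 3 → ℤ, ¬ (((a : Fin 3 → ℤ) ≠ 0 ∧ (a) ⬝ᵥ (a) ≤ ((N : ℕ) : ℤ) ^ 2) ∧ ((b : Fin 3 → ℤ) ≠ 0 ∧ (b) ⬝ᵥ (b) ≤ ((N : ℕ) : ℤ) ^ 2)) → Q a b = 0)) (hsymm : ∀ a b, Q b a = (Q a b)ᵀ)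
    (hrow : ∀ a b, (fun i : Fin 3 => (((a : Fin 3 → ℤ) i : ℤ) : ℂ)) ᵥ* Q a b = 0) (hcol : ∀ a b, Q a b *ᵥ (fun i : Fin 3 => (((b : Fin 3 → ℤ) i : ℤ) : ℂ)) = 0) (hpol : (∀ (k₁ k₂ k₃ : Fin 3 → ℤ) (v₁ v₂ v₃ : Fin 3 → ℂ), ((k₁ : Fin 3 → ℤ) ≠ 0 ∧ (k₁) ⬝ᵥ (k₁) ≤ ((N : ℕ) : ℤ) ^ 2) → ((k₂ : Fin 3 → ℤ) ≠ 0 ∧ (k₂) ⬝ᵥ (k₂) ≤ ((N : ℕ) : ℤ) ^ 2) → ((k₃ : Fin 3 → ℤ) ≠ 0 ∧ (k₃) ⬝ᵥ (k₃) ≤ ((N : ℕ) : ℤ) ^ 2) → v₁ ⬝ᵥ (fun i : Fin 3 => (((k₁ : Fin 3 → ℤ) i : ℤ) : ℂ)) = 0 → v₂ ⬝ᵥ (fun i : Fin 3 => (((k₂ : Fin 3 → ℤ) i : ℤ) : ℂ)) = 0 → v₃ ⬝ᵥ (fun i : Fin 3 => (((k₃ : Fin 3 → ℤ) i : ℤ)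 : ℂ)) = 0 → (((v₁) ⬝ᵥ (fun i : Fin 3 => (((k₂ : Fin 3 → ℤ) i : ℤ) : ℂ))) • (v₂) + ((v₂) ⬝ᵥ (fun i : Fin 3 => (((k₁ : Fin 3 → ℤ) i : ℤ) : ℂ))) • (v₁) : Fin 3 → ℂ) ⬝ᵥ (Q (k₁ + k₂) k₃ *ᵥ v₃) + (((v₁) ⬝ᵥ (fun i : Fin 3 => (((k₃ : Fin 3 → ℤ) i : ℤ) : ℂ))) • (v₃) + ((v₃) ⬝ᵥ (fun i : Fin 3 => (((k₁ : Fin 3 → ℤ) i : ℤ) : ℂ))) • (v₁) : Fin 3 → ℂ) ⬝ᵥ (Q (k₁ + k₃) k₂ *ᵥ v₂) + (((v₂) ⬝ᵥ (fun i : Fin 3 => (((k₃ : Fin 3 → ℤ) i : ℤ) : ℂ))) • (v₃) + ((v₃) ⬝ᵥ (fun i : Fin 3 => (((k₂ : Fin 3 → ℤ) i : ℤ) : ℂ))) • (v₂) : Fin 3 → ℂ) ⬝ᵥ (Q (k₂ + k₃) k₁ *ᵥ v₁) = 0))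
    (haxial : ∀ a b, Q a b ≠ 0 → (a + b) 0 = 0 ∧ (a + b) 2 = 0) (a b : Fin 3 → ℤ)
    (hab : a + b ≠ 0) : Q a b = 0 := by
  by_contra hQ
  obtain ⟨h0, h2⟩ := haxial a b hQ
  have h1 : (a + b) 1 ≠ 0 := fun h => hab (funext fun i => by fin_cases i <;> assumption)
  rcases lt_or_gt_of_ne h1 with hneg | hpos
  · -- reflect: `Q' a b := Q (-a) (-b)` satisfies all hypotheses, and `-(a+b)` has `m > 0`
    refine hQ ?_
    have key := offcentre_pos (fun a b => Q (-a) (-b)) hN (fun a b h => hsupp (-a) (-b) fun h' =>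
        h ⟨by simpa using ball_neg h'.1, by simpa using ball_neg h'.2⟩) (fun a b => hsymm (-a) (-b))
      (fun a b => by have := hrow (-a) (-b); rwa [castVec_neg, Matrix.neg_vecMul, neg_eq_zero] at this)
      (fun a b => by have := hcol (-a) (-b); rwa [castVec_neg, Matrix.mulVec_neg, neg_eq_zero] at this)
      ?_ (θ := -(a + b)) (by simp [h0]) (by simp [h2]) (by simp only [Pi.neg_apply]; linarith) (-a) (-b)
      (by abel)
    · simpa using key
    intro k₁ k₂ k₃ v₁ v₂ v₃ hk₁ hk₂ hk₃ e₁ e₂ e₃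
    have h := hpol (-k₁) (-k₂) (-k₃) v₁ v₂ v₃ (ball_neg hk₁) (ball_neg hk₂) (ball_neg hk₃)
      (by rw [castVec_neg, dotProduct_neg, e₁, neg_zero]) (by rw [castVec_neg, dotProduct_neg, e₂, neg_zero])
      (by rw [castVec_neg, dotProduct_neg, e₃, neg_zero])
    simp only [castVec_neg, dotProduct_neg, neg_smul, ← neg_add, neg_dotProduct, neg_eq_zero] at h
    exact h
  · exact hQ (offcentre_pos Q hN hsupp hsymm hrow hcol hpol h0 h2 hpos a b rfl)

end Summit.AnomalousDissipation.AnomalousDissipation.Theorems.MomentParityQuarticGate.AxialQuad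

namespace Summit.AnomalousDissipation.AnomalousDissipation.Theorems.MomentParityQuarticGate

-- the summit-side namespace repeats `AnomalousDissipation` by the tree's convention
set_option linter.dupNamespace false in
/-- **Registered sub-goal `axialQuad_off` of stub S2q** (summary of this file): OFF-CENTRE VANISHING — for an axial block family, every block `Q a b` with `a + b ≠ 0` vanishes. [folklore] -/
theorem axialQuad_off : ∀ (Q : ((Fin 3 → ℤ) → (Fin 3 → ℤ) → Matrix (Fin 3) (Fin 3) ℂ)) (N : ℕ), 2 ≤ N → (∀ a b : Fin 3 → ℤ, ¬ (((a : Fin 3 → ℤ) ≠ 0 ∧ (a) ⬝ᵥ (a) ≤ ((N : ℕ) : ℤ) ^ 2) ∧ ((b : Fin 3 → ℤ) ≠ 0 ∧ (b) ⬝ᵥ (b) ≤ ((N : ℕ) : ℤ) ^ 2)) → Q a b = 0) → (∀ a b : Fin 3 → ℤ, Q b a = Matrix.transpose (Q a b)) → (∀ a b : Fin 3 → ℤ, Matrix.vecMul (fun i : Fin 3 => (((a : Fin 3 → ℤ) i : ℤ) : ℂ)) (Q a b) = 0) → (∀ a b : Fin 3 → ℤ, Matrix.mulVec (Q a b) (fun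 i : Fin 3 => (((b : Fin 3 → ℤ) i : ℤ) : ℂ)) = 0) → (∀ (k₁ k₂ k₃ : Fin 3 → ℤ) (v₁ v₂ v₃ : Fin 3 → ℂ), ((k₁ : Fin 3 → ℤ) ≠ 0 ∧ (k₁) ⬝ᵥ (k₁) ≤ ((N : ℕ) : ℤ) ^ 2) → ((k₂ : Fin 3 → ℤ) ≠ 0 ∧ (k₂) ⬝ᵥ (k₂) ≤ ((N : ℕ) : ℤ) ^ 2) → ((k₃ : Fin 3 → ℤ) ≠ 0 ∧ (k₃) ⬝ᵥ (k₃) ≤ ((N : ℕ) : ℤ) ^ 2) → v₁ ⬝ᵥ (fun i : Fin 3 => (((k₁ : Fin 3 → ℤ) i : ℤ) : ℂ)) = 0 → v₂ ⬝ᵥ (fun i : Fin 3 => (((k₂ : Fin 3 → ℤ) i : ℤ) : ℂ)) = 0 → v₃ ⬝ᵥ (fun i : Fin 3 => (((k₃ : Fin 3 → ℤ) i : ℤ) : ℂ)) = 0 → (((v₁) ⬝ᵥ (fun i : Fin 3 => (((k₂ : Fin 3 → ℤ) i : ℤ) : ℂ))) • (v₂) + ((v₂) ⬝ᵥ (fun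 i : Fin 3 => (((k₁ : Fin 3 → ℤ) i : ℤ) : ℂ))) • (v₁) : Fin 3 → ℂ) ⬝ᵥ (Matrix.mulVec (Q (k₁ + k₂) k₃) v₃) + (((v₁) ⬝ᵥ (fun i : Fin 3 => (((k₃ : Fin 3 → ℤ) i : ℤ) : ℂ))) • (v₃) + ((v₃) ⬝ᵥ (fun i : Fin 3 => (((k₁ : Fin 3 → ℤ) i : ℤ) : ℂ))) • (v₁) : Fin 3 → ℂ) ⬝ᵥ (Matrix.mulVec (Q (k₁ + k₃) k₂) v₂) + (((v₂) ⬝ᵥ (fun i : Fin 3 => (((k₃ : Fin 3 → ℤ) i : ℤ) : ℂ))) • (v₃) + ((v₃) ⬝ᵥ (fun i : Fin 3 => (((k₂ : Fin 3 → ℤ) i : ℤ) : ℂ))) • (v₂) : Fin 3 → ℂ) ⬝ᵥ (Matrix.mulVec (Q (k₂ + k₃) k₁) v₁) = 0) → (∀ a b : Fin 3 → ℤ, Q a b ≠ 0 → (a + b) 0 = 0 ∧ (a + b) 2 = 0) → ∀ (a b : Fin 3 → ℤ), a + b ≠ 0 → Q a b = 0 :=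
  fun Q _ hN hsupp hsymm hrow hcol hpol hax a b hab => AxialQuad.offcentre Q hN hsupp hsymm hrow hcol hpol hax a b hab

end Summit.AnomalousDissipation.AnomalousDissipation.Theorems.MomentParityQuarticGate
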